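import Literature.NumberTheory.EllipticCurves.RationalIsogenyFrobeniusCriterion
import Literature.NumberTheory.EllipticCurves.RationalIsogenyFrobeniusCertificates17
import Literature.NumberTheory.EllipticCurves.RationalIsogenyFrobeniusCertificates19and37
import HarnessLib

/-!
# Crux `MazurKenkuBound` (stmt-ABC-15125), line `Sketch` — stub `stub_certMid`:
# no rational `7`- or `13`-isogeny out of the `j`-tables of `X₀(17)`, `X₀(19)`, `X₀(37)`

Kenku 1982, proof of Thm. 1, case (c), at the levels `7N` and `13N` for `N ∈ {17, 19, 37}`: a
cyclic `ℚ`-isogeny of degree `7N` or `13N` would give, out of one elliptic curve over `ℚ`, a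
rational `N`-isogeny — so `j` lies in the table of `X₀(N)`:
`17 ↦ {-17²·101³/2, -17·373³/2¹⁷}`, `19 ↦ {-96³}`, `37 ↦ {-7·11³, -7·137³·2083³}` — and a rational
`7`- resp. `13`-isogeny. The latter is refuted, `j` by `j`, by a Frobenius certificate (Mazur 1978,
Prop. 6.3 (1)): for the globally minimal integer model `E₀` with that `j` and a good prime `ℓ`,
`X² − a_ℓX + ℓ` must have a root modulo the isogeny degree `q`, and it has none modulo `7` and
`13`.

All the arithmetic is in the landed criterion
`Literature.NumberTheory.EllipticCurves.j_ne_of_isogeny_prime_degree_of_certificate'`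
(`RationalIsogenyFrobeniusCriterion.lean`) and the kernel-decided point counts
`KenkuLevelsCert.card_E17_*`, `card_E19_*`, `card_E37_*`
(`RationalIsogenyFrobeniusCertificates17.lean`, `RationalIsogenyFrobeniusCertificates19and37.lean`);
this file only feeds them the five rows of data:

* `j = -297756989/2`: `E₀ = [1, 0, 1, -3041, 64278]`, `Δ = -2·5³·17⁴`, `ℓ = 3`, `#Ẽ₀(𝔽₃) = 6`
  (`a₃ = -2`);
* `j = -882216989/131072`: `E₀ = [1, 1, 0, -660, -7600]`, `Δ = -2¹⁷·5³·17²` (`c₄ = 31705` odd),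
  `ℓ = 3`, `#Ẽ₀(𝔽₃) = 2` (`a₃ = 2`);
* `j = -884736`: `E₀ = [0, 0, 1, -38, 90]`, `Δ = -19³`, `ℓ = 2`, `#Ẽ₀(𝔽₂) = 3` (`a₂ = 0`);
* `j = -9317`: `E₀ = [1, 1, 1, -8, 6]`, `Δ = -5³·7²`, `ℓ = 3`, `#Ẽ₀(𝔽₃) = 5` (`a₃ = -1`);
* `j = -162677523113838677`: `E₀ = [1, 1, 1, -208083, -36621194]`, `Δ = -5³·7²`, `ℓ = 3`,
  `#Ẽ₀(𝔽₃) = 5` (`a₃ = -1`).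

`X² + 2X + 3`, `X² − 2X + 3`, `X² + 2` and `X² + X + 3` are root-free modulo `7` and modulo `13`
(`decide`).

## References

* [Mazur1978] B. Mazur, *Rational isogenies of prime degree*, Invent. Math. 44 (1978) 129–162,
  §6 Prop. 6.3 (1) (p. 153), Thm. 1 and the table p. 129 (`X₀(17)`, `X₀(19)`, `X₀(37)`).
* [Kenku1982] M. A. Kenku, *On the number of ℚ-isomorphism classes of elliptic curves in each
  ℚ-isogeny class*, J. Number Theory 15 (1982) 199–202, proof of Thm. 1, case (c), p. 201.
-/

-- `Summit.ABC.ABC` is the mandated summit-side namespace (CONVENTIONS §2); the duplicate is deliberate.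
set_option linter.dupNamespace false

noncomputable section

open scoped Classical
open WeierstrassCurve
open Literature.NumberTheory.EllipticCurves

namespace Summit.ABC.ABC.Theorems

/-- No `ℚ`-isogeny of degree `7` or `13` out of an elliptic curve over `ℚ` with
`j = -297756989/2 = -17²·101³/2` (model `[1, 0, 1, -3041, 64278]`, `Δ = -2·5³·17⁴`, witness prime
`ℓ = 3`, `a₃ = -2`: `X² + 2X + 3` has no root modulo `7` or `13`).
[cite: Mazur1978, §6 Prop. 6.3 (1) (p. 153)]
[cite: Kenku1982, proof of Thm. 1, case (c), p. 201] -/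
private theorem j_ne_jm297756989d2 {W W' : WeierstrassCurve ℚ} [W.IsElliptic] [W'.IsElliptic]
    (ψ : Isogeny W W') (hq : ψ.degree = 7 ∨ ψ.degree = 13) : W.j ≠ -297756989 / 2 := by
  have hj : (((⟨1, 0, 1, -3041, 64278⟩ : WeierstrassCurve ℤ)).c₄ : ℚ) ^ 3 /
      (((⟨1, 0, 1, -3041, 64278⟩ : WeierstrassCurve ℤ)).Δ : ℚ) = -297756989 / 2 := by
    norm_num [WeierstrassCurve.Δ, WeierstrassCurve.c₄, WeierstrassCurve.b₂, WeierstrassCurve.b₄,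
      WeierstrassCurve.b₆, WeierstrassCurve.b₈]
  -- the two root-freeness certificates, decided BEFORE any local `Fact` instance is introduced
  -- (a local `Fact (Nat.Prime q)` would be picked up by `Fintype (ZMod q)` and block `decide`)
  have hnr7 : ∀ t : ZMod 7,
      t ^ 2 - (((3 : ℕ) : ℤ) + 1 - (6 : ℕ) : ℤ) * t + ((3 : ℕ) : ZMod 7) ≠ 0 := by
    decide +kernel
  have hnr13 : ∀ t : ZMod 13,
      t ^ 2 - (((3 : ℕ) : ℤ) + 1 - (6 : ℕ) : ℤ) * t + ((3 : ℕ) : ZMod 13) ≠ 0 := by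
    decide +kernel
  rw [← hj]
  haveI : Fact (Nat.Prime 3) := ⟨by norm_num⟩
  rcases hq with hq | hq
  · haveI : Fact (Nat.Prime 7) := ⟨by norm_num⟩
    exact j_ne_of_isogeny_prime_degree_of_certificate' _ (B := 5) (by decide +kernel)
      (by decide +kernel) (by decide +kernel) (by decide +kernel) (ℓ := 3) (by decide +kernel)
      KenkuLevelsCert.card_E17_jm297756989d2_3 (q := 7) (by norm_num) hnr7 ψ hq
  · haveI : Fact (Nat.Prime 13) := ⟨by norm_num⟩
    exact j_ne_of_isogeny_prime_degree_of_certificate' _ (B := 5) (by decide +kernel)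
      (by decide +kernel) (by decide +kernel) (by decide +kernel) (ℓ := 3) (by decide +kernel)
      KenkuLevelsCert.card_E17_jm297756989d2_3 (q := 13) (by norm_num) hnr13 ψ hq

/-- No `ℚ`-isogeny of degree `7` or `13` out of an elliptic curve over `ℚ` with
`j = -882216989/131072 = -17·373³/2¹⁷` (model `[1, 1, 0, -660, -7600]`, `Δ = -2¹⁷·5³·17²`,
`c₄ = 31705` odd, witness prime `ℓ = 3`, `a₃ = 2`: `X² − 2X + 3` has no root modulo `7` or `13`).
[cite: Mazur1978, §6 Prop. 6.3 (1) (p. 153)]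
[cite: Kenku1982, proof of Thm. 1, case (c), p. 201] -/
private theorem j_ne_jm882216989d131072 {W W' : WeierstrassCurve ℚ} [W.IsElliptic]
    [W'.IsElliptic] (ψ : Isogeny W W') (hq : ψ.degree = 7 ∨ ψ.degree = 13) :
    W.j ≠ -882216989 / 131072 := by
  have hj : (((⟨1, 1, 0, -660, -7600⟩ : WeierstrassCurve ℤ)).c₄ : ℚ) ^ 3 /
      (((⟨1, 1, 0, -660, -7600⟩ : WeierstrassCurve ℤ)).Δ : ℚ) = -882216989 / 131072 := by
    norm_num [WeierstrassCurve.Δ, WeierstrassCurve.c₄, WeierstrassCurve.b₂, WeierstrassCurve.b₄,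
      WeierstrassCurve.b₆, WeierstrassCurve.b₈]
  have hnr7 : ∀ t : ZMod 7,
      t ^ 2 - (((3 : ℕ) : ℤ) + 1 - (2 : ℕ) : ℤ) * t + ((3 : ℕ) : ZMod 7) ≠ 0 := by
    decide +kernel
  have hnr13 : ∀ t : ZMod 13,
      t ^ 2 - (((3 : ℕ) : ℤ) + 1 - (2 : ℕ) : ℤ) * t + ((3 : ℕ) : ZMod 13) ≠ 0 := by
    decide +kernel
  rw [← hj]
  haveI : Fact (Nat.Prime 3) := ⟨by norm_num⟩
  rcases hq with hq | hq
  · haveI : Fact (Nat.Prime 7) := ⟨by norm_num⟩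
    exact j_ne_of_isogeny_prime_degree_of_certificate' _ (B := 7) (by decide +kernel)
      (by decide +kernel) (by decide +kernel) (by decide +kernel) (ℓ := 3) (by decide +kernel)
      KenkuLevelsCert.card_E17_jm882216989d131072_3 (q := 7) (by norm_num) hnr7 ψ hq
  · haveI : Fact (Nat.Prime 13) := ⟨by norm_num⟩
    exact j_ne_of_isogeny_prime_degree_of_certificate' _ (B := 7) (by decide +kernel)
      (by decide +kernel) (by decide +kernel) (by decide +kernel) (ℓ := 3) (by decide +kernel)
      KenkuLevelsCert.card_E17_jm882216989d131072_3 (q := 13) (by norm_num) hnr13 ψ hq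

/-- No `ℚ`-isogeny of degree `7` or `13` out of an elliptic curve over `ℚ` with
`j = -884736 = -96³` (CM by `-19`; model `[0, 0, 1, -38, 90]`, `Δ = -19³`, witness prime `ℓ = 2`,
`a₂ = 0`: `X² + 2` has no root modulo `7` or `13`). [cite: Mazur1978, §6 Prop. 6.3 (1) (p. 153)]
[cite: Kenku1982, proof of Thm. 1, case (c), p. 201] -/
private theorem j_ne_jm884736 {W W' : WeierstrassCurve ℚ} [W.IsElliptic] [W'.IsElliptic]
    (ψ : Isogeny W W') (hq : ψ.degree = 7 ∨ ψ.degree = 13) : W.j ≠ -884736 := by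
  have hj : (((⟨0, 0, 1, -38, 90⟩ : WeierstrassCurve ℤ)).c₄ : ℚ) ^ 3 /
      (((⟨0, 0, 1, -38, 90⟩ : WeierstrassCurve ℤ)).Δ : ℚ) = -884736 := by
    norm_num [WeierstrassCurve.Δ, WeierstrassCurve.c₄, WeierstrassCurve.b₂, WeierstrassCurve.b₄,
      WeierstrassCurve.b₆, WeierstrassCurve.b₈]
  have hnr7 : ∀ t : ZMod 7,
      t ^ 2 - (((2 : ℕ) : ℤ) + 1 - (3 : ℕ) : ℤ) * t + ((2 : ℕ) : ZMod 7) ≠ 0 := by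
    decide +kernel
  have hnr13 : ∀ t : ZMod 13,
      t ^ 2 - (((2 : ℕ) : ℤ) + 1 - (3 : ℕ) : ℤ) * t + ((2 : ℕ) : ZMod 13) ≠ 0 := by
    decide +kernel
  rw [← hj]
  haveI : Fact (Nat.Prime 2) := ⟨by norm_num⟩
  rcases hq with hq | hq
  · haveI : Fact (Nat.Prime 7) := ⟨by norm_num⟩
    exact j_ne_of_isogeny_prime_degree_of_certificate' _ (B := 3) (by decide +kernel)
      (by decide +kernel) (by decide +kernel) (by decide +kernel) (ℓ := 2) (by decide +kernel)
      KenkuLevelsCert.card_E19_jm884736_2 (q := 7) (by norm_num) hnr7 ψ hq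
  · haveI : Fact (Nat.Prime 13) := ⟨by norm_num⟩
    exact j_ne_of_isogeny_prime_degree_of_certificate' _ (B := 3) (by decide +kernel)
      (by decide +kernel) (by decide +kernel) (by decide +kernel) (ℓ := 2) (by decide +kernel)
      KenkuLevelsCert.card_E19_jm884736_2 (q := 13) (by norm_num) hnr13 ψ hq

/-- No `ℚ`-isogeny of degree `7` or `13` out of an elliptic curve over `ℚ` with
`j = -9317 = -7·11³` (model `[1, 1, 1, -8, 6]`, `Δ = -5³·7²`, witness prime `ℓ = 3`, `a₃ = -1`:
`X² + X + 3` has no root modulo `7` or `13`). [cite: Mazur1978, §6 Prop. 6.3 (1) (p. 153)]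
[cite: Kenku1982, proof of Thm. 1, case (c), p. 201] -/
private theorem j_ne_jm9317 {W W' : WeierstrassCurve ℚ} [W.IsElliptic] [W'.IsElliptic]
    (ψ : Isogeny W W') (hq : ψ.degree = 7 ∨ ψ.degree = 13) : W.j ≠ -9317 := by
  have hj : (((⟨1, 1, 1, -8, 6⟩ : WeierstrassCurve ℤ)).c₄ : ℚ) ^ 3 /
      (((⟨1, 1, 1, -8, 6⟩ : WeierstrassCurve ℤ)).Δ : ℚ) = -9317 := by
    norm_num [WeierstrassCurve.Δ, WeierstrassCurve.c₄, WeierstrassCurve.b₂, WeierstrassCurve.b₄,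
      WeierstrassCurve.b₆, WeierstrassCurve.b₈]
  have hnr7 : ∀ t : ZMod 7,
      t ^ 2 - (((3 : ℕ) : ℤ) + 1 - (5 : ℕ) : ℤ) * t + ((3 : ℕ) : ZMod 7) ≠ 0 := by
    decide +kernel
  have hnr13 : ∀ t : ZMod 13,
      t ^ 2 - (((3 : ℕ) : ℤ) + 1 - (5 : ℕ) : ℤ) * t + ((3 : ℕ) : ZMod 13) ≠ 0 := by
    decide +kernel
  rw [← hj]
  haveI : Fact (Nat.Prime 3) := ⟨by norm_num⟩
  rcases hq with hq | hq
  · haveI : Fact (Nat.Prime 7) := ⟨by norm_num⟩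
    exact j_ne_of_isogeny_prime_degree_of_certificate' _ (B := 3) (by decide +kernel)
      (by decide +kernel) (by decide +kernel) (by decide +kernel) (ℓ := 3) (by decide +kernel)
      KenkuLevelsCert.card_E37_jm9317_3 (q := 7) (by norm_num) hnr7 ψ hq
  · haveI : Fact (Nat.Prime 13) := ⟨by norm_num⟩
    exact j_ne_of_isogeny_prime_degree_of_certificate' _ (B := 3) (by decide +kernel)
      (by decide +kernel) (by decide +kernel) (by decide +kernel) (ℓ := 3) (by decide +kernel)
      KenkuLevelsCert.card_E37_jm9317_3 (q := 13) (by norm_num) hnr13 ψ hq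

/-- No `ℚ`-isogeny of degree `7` or `13` out of an elliptic curve over `ℚ` with
`j = -162677523113838677 = -7·137³·2083³` (model `[1, 1, 1, -208083, -36621194]`, `Δ = -5³·7²`,
witness prime `ℓ = 3`, `a₃ = -1`: `X² + X + 3` has no root modulo `7` or `13`).
[cite: Mazur1978, §6 Prop. 6.3 (1) (p. 153)]
[cite: Kenku1982, proof of Thm. 1, case (c), p. 201] -/
private theorem j_ne_jm162677523113838677 {W W' : WeierstrassCurve ℚ} [W.IsElliptic]
    [W'.IsElliptic] (ψ : Isogeny W W') (hq : ψ.degree = 7 ∨ ψ.degree = 13) :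
    W.j ≠ -162677523113838677 := by
  have hj : (((⟨1, 1, 1, -208083, -36621194⟩ : WeierstrassCurve ℤ)).c₄ : ℚ) ^ 3 /
      (((⟨1, 1, 1, -208083, -36621194⟩ : WeierstrassCurve ℤ)).Δ : ℚ) = -162677523113838677 := by
    norm_num [WeierstrassCurve.Δ, WeierstrassCurve.c₄, WeierstrassCurve.b₂, WeierstrassCurve.b₄,
      WeierstrassCurve.b₆, WeierstrassCurve.b₈]
  have hnr7 : ∀ t : ZMod 7,
      t ^ 2 - (((3 : ℕ) : ℤ) + 1 - (5 : ℕ) : ℤ) * t + ((3 : ℕ) : ZMod 7) ≠ 0 := by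
    decide +kernel
  have hnr13 : ∀ t : ZMod 13,
      t ^ 2 - (((3 : ℕ) : ℤ) + 1 - (5 : ℕ) : ℤ) * t + ((3 : ℕ) : ZMod 13) ≠ 0 := by
    decide +kernel
  rw [← hj]
  haveI : Fact (Nat.Prime 3) := ⟨by norm_num⟩
  rcases hq with hq | hq
  · haveI : Fact (Nat.Prime 7) := ⟨by norm_num⟩
    exact j_ne_of_isogeny_prime_degree_of_certificate' _ (B := 3) (by decide +kernel)
      (by decide +kernel) (by decide +kernel) (by decide +kernel) (ℓ := 3) (by decide +kernel)
      KenkuLevelsCert.card_E37_jm162677523113838677_3 (q := 7) (by norm_num) hnr7 ψ hq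
  · haveI : Fact (Nat.Prime 13) := ⟨by norm_num⟩
    exact j_ne_of_isogeny_prime_degree_of_certificate' _ (B := 3) (by decide +kernel)
      (by decide +kernel) (by decide +kernel) (by decide +kernel) (ℓ := 3) (by decide +kernel)
      KenkuLevelsCert.card_E37_jm162677523113838677_3 (q := 13) (by norm_num) hnr13 ψ hq

/-- **Kenku 1982, case (c), levels `7N` and `13N` for `N ∈ {17, 19, 37}`, per `j`.** No elliptic
curve over `ℚ` whose `j`-invariant lies in the table of `X₀(17)`, `X₀(19)` or `X₀(37)`,
`j ∈ {-17²·101³/2, -17·373³/2¹⁷, -96³, -7·11³, -7·137³·2083³}`, admits a `ℚ`-isogeny of degree `7`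
or `13`: by Mazur 1978, Prop. 6.3 (1), such an isogeny out of the globally minimal models
`[1,0,1,-3041,64278]`, `[1,1,0,-660,-7600]`, `[0,0,1,-38,90]`, `[1,1,1,-8,6]`,
`[1,1,1,-208083,-36621194]` would force a root of `X² − a_ℓX + ℓ` modulo `7` resp. `13` at the
good primes `ℓ = 3, 3, 2, 3, 3` (`a₃ = -2, 2`, `a₂ = 0`, `a₃ = -1, -1`), and there is none.
[cite: Mazur1978, §6 Prop. 6.3 (1) (p. 153)]
[cite: Kenku1982, proof of Thm. 1, case (c), p. 201] -/
theorem stub_certMid :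
    ∀ (W W' : WeierstrassCurve ℚ) [W.IsElliptic] [W'.IsElliptic] (ψ : Isogeny W W'),
      (ψ.degree = 7 ∨ ψ.degree = 13) →
        W.j ∉ ({-297756989 / 2, -882216989 / 131072, -884736, -9317, -162677523113838677} :
          Finset ℚ) := by
  intro W W' _ _ ψ hq hmem
  simp only [Finset.mem_insert, Finset.mem_singleton] at hmem
  rcases hmem with h | h | h | h | h
  · exact j_ne_jm297756989d2 ψ hq h
  · exact j_ne_jm882216989d131072 ψ hq h
  · exact j_ne_jm884736 ψ hq h
  · exact j_ne_jm9317 ψ hq h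
  · exact j_ne_jm162677523113838677 ψ hq h

end Summit.ABC.ABC.Theorems

end
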